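import Summits.ValiantsHypothesis.ValiantsHypothesis.Theses.SOSTau

/-!
# ValiantsHypothesis / SOSTau — item `OfSOSTau` (stmt-ValiantsHypothesis-18752), closed

The SOS-`τ` conjecture (`≤ c · Σ|supp g_i|` distinct real zeros for weighted sums of sparse squares)
gives the target: a real SOS representation of Tavenas' `V_n` has `2^n - 1` distinct real zeros
(tree `card_roots_toFinset_map_tavenasV`), so `2^n - 1 ≤ c · S`, whence `S ≥ 2^n / (2(c+1))` for
`n ≥ 1`; take `η = 1/(2(c+1))`. HONEST FRAMING: bookkeeping; the SOS-`τ` conjecture is OPEN; nothing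
here is progress on `VP ≠ VNP`.
-/

-- layout Summits/ValiantsHypothesis/ValiantsHypothesis forces the duplicated namespace component
set_option linter.dupNamespace false

namespace Summit.ValiantsHypothesis.ValiantsHypothesis.Theorems.SOSTau

open Literature.Computability.AlgebraicComplexity

/-- **Item `OfSOSTau` (stmt-ValiantsHypothesis-18752).** [folklore] -/
theorem ofSOSTau_proof : Theses.SOSTau.OfSOSTau := by
  unfold Theses.SOSTau.OfSOSTau
  rintro ⟨c, hc⟩
  refine ⟨1 / (2 * ((c : ℝ) + 1)), by positivity, 1, fun n hn s a g hrep => ?_⟩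
  have hroots := hc s a g
  rw [hrep, card_roots_toFinset_map_tavenasV] at hroots
  -- `2^n - 1 ≤ c * S` in ℕ, and `2^n ≤ 2 (2^n - 1)` for `n ≥ 1`
  have h2n : (2 : ℝ) ^ n ≤ 2 * ((2 ^ n - 1 : ℕ) : ℝ) := by
    have h1 : 1 ≤ 2 ^ n := Nat.one_le_two_pow
    have : (2 : ℕ) ^ n ≤ 2 * (2 ^ n - 1) := by
      have : 2 ≤ 2 ^ n := by
        calc 2 = 2 ^ 1 := by norm_num
          _ ≤ 2 ^ n := Nat.pow_le_pow_right (by norm_num) hn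
      omega
    exact_mod_cast this
  have hcS : ((2 ^ n - 1 : ℕ) : ℝ) ≤ (c : ℝ) * ∑ i, ((g i).support.card : ℝ) := by
    have := hroots
    exact_mod_cast this
  have hS0 : 0 ≤ ∑ i, ((g i).support.card : ℝ) := Finset.sum_nonneg fun i _ => by positivity
  rw [div_mul_eq_mul_div, one_mul, div_le_iff₀ (by positivity)]
  nlinarith

end Summit.ValiantsHypothesis.ValiantsHypothesis.Theorems.SOSTau
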